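import Mathlib
import HarnessLib

/-!
# Transcendence measure for `e` (Nesterenko–Waldschmidt 1996) — I: Liouville's inequality

Topic `Literature/NumberTheory/Transcendental`; sibling proof file of
`ExpOneTranscendenceMeasure.lean` (the named fact
`Literature.NumberTheory.Transcendental.NesterenkoWaldschmidt1996_thm_4_2`, Theorem 4 (2) of
[NesterenkoWaldschmidt1996]). Everything here is PROVED; no definitions, no named facts.

This part is the arithmetic lower bound of the proof, Lemma 5 of [NesterenkoWaldschmidt1996, §5]
("Liouville's inequality", quoted there from Fel'dman, *Hilbert's seventh problem*, Lemma 9.2), in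
the one-variable form which is all that is needed for `θ = β = 1`:

* `NW1996.liouville`: if `ξ ∈ ℂ` is a root of `Q ∈ ℤ[X]`, `Q` irreducible over `ℚ` of degree `d`,
  and `G ∈ ℤ[X]` has degree `≤ n`... precisely `n = deg G`, `G(ξ) ≠ 0` and length `L(G) ≤ Λ`, then
  `max(1,|ξ|)^n ≤ Λ^{d-1} · M(Q)^n · |G(ξ)|`, where `M(Q)` is the Mahler measure of `Q` (so that
  `d · h(ξ) = log M(Q)`; this is `log|G(ξ)| ≥ -(d-1) log L(G) - d n h(ξ)` of Lemma 5 with `D' = D`,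
  keeping the factor `max(1,|ξ|)^n` which the proof gives for free).

Proof as printed in Fel'dman: the resultant `Res(Q, G)` is a non-zero integer (irreducibility of
`Q` and `G(ξ) ≠ 0` make `Q, G` coprime over `ℚ`, Mathlib's `Polynomial.resultant_ne_zero`), and over
`ℂ` it equals `a^n ∏_{Q(ρ)=0} G(ρ)` (`Polynomial.resultant_eq_prod_roots_sub`); each factor with
`ρ ≠ ξ` is at most `L(G) max(1,|ρ|)^n`, and `|a| ∏ max(1,|ρ|) = M(Q)`
(`Polynomial.mahlerMeasure_eq_leadingCoeff_mul_prod_roots`).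

Also recorded here: the trivial bounds `|G(ρ)| ≤ L(G) max(1,|ρ|)^n` (`NW1996.norm_aeval_le_length_mul`)
and `L(G) ≤ 2^n M(G)` (`NW1996.length_le_two_pow_mul_mahlerMeasure`).

## References

* [NesterenkoWaldschmidt1996] Yu. V. Nesterenko, M. Waldschmidt, *On the approximation of the values
  of exponential function and logarithm by algebraic numbers* (Russian), Mat. Zapiski 2 (1996),
  23–42; English version arXiv:math/0002047, §5 Lemma 5.
* N. I. Fel'dman, *Hilbert's seventh problem*, Moscow State Univ. 1982, Lemma 9.2 (not held; the
  resultant proof is the standard one).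
-/

noncomputable section

open Polynomial Complex Finset

namespace Literature.NumberTheory.Transcendental

namespace NW1996

/-! ### Lengths and values -/

/-- `|G(ρ)| ≤ L(G) · max(1,|ρ|)^n` for `G ∈ ℤ[X]` of degree `n` (triangle inequality).
[folklore] -/
theorem norm_aeval_le_length_mul (G : ℤ[X]) (ρ : ℂ) :
    ‖aeval ρ G‖ ≤ (∑ k ∈ range (G.natDegree + 1), |(G.coeff k : ℝ)|) * max 1 ‖ρ‖ ^ G.natDegree := by
  rw [aeval_def, eval₂_eq_eval_map, eval_eq_sum_range,
    natDegree_map_eq_of_injective (RingHom.injective_int (algebraMap ℤ ℂ)), Finset.sum_mul]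
  refine (norm_sum_le _ _).trans (Finset.sum_le_sum fun k hk => ?_)
  rw [coeff_map, norm_mul, norm_pow, eq_intCast, Complex.norm_intCast]
  refine mul_le_mul_of_nonneg_left ?_ (abs_nonneg _)
  calc ‖ρ‖ ^ k ≤ max 1 ‖ρ‖ ^ k := pow_le_pow_left₀ (norm_nonneg _) (le_max_right _ _) _
    _ ≤ max 1 ‖ρ‖ ^ G.natDegree :=
        pow_le_pow_right₀ (le_max_left _ _) (Nat.lt_succ_iff.mp (Finset.mem_range.mp hk))

/-- The length is non-negative. [folklore] -/
theorem length_nonneg (G : ℤ[X]) : 0 ≤ ∑ k ∈ range (G.natDegree + 1), |(G.coeff k : ℝ)| :=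
  Finset.sum_nonneg fun _ _ => abs_nonneg _

/-- A non-zero integer polynomial has length `≥ 1`. [folklore] -/
theorem one_le_length {G : ℤ[X]} (hG : G ≠ 0) :
    1 ≤ ∑ k ∈ range (G.natDegree + 1), |(G.coeff k : ℝ)| := by
  have hmem : G.natDegree ∈ range (G.natDegree + 1) := by simp
  have hlc : (1 : ℝ) ≤ |(G.coeff G.natDegree : ℝ)| := by
    have h : G.leadingCoeff ≠ 0 := leadingCoeff_ne_zero.mpr hG
    rw [← Int.cast_abs]
    exact_mod_cast Int.one_le_abs h
  exact hlc.trans (Finset.single_le_sum (f := fun k => |(G.coeff k : ℝ)|) (fun _ _ => abs_nonneg _) hmem)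

/-- `L(G) ≤ 2^n · M(G)`: each coefficient is at most `C(n,k) M(G)`
(`Polynomial.norm_coeff_le_choose_mul_mahlerMeasure`) and `∑ C(n,k) = 2^n`. [folklore] -/
theorem length_le_two_pow_mul_mahlerMeasure (G : ℤ[X]) :
    (∑ k ∈ range (G.natDegree + 1), |(G.coeff k : ℝ)|) ≤
      2 ^ G.natDegree * (G.map (Int.castRingHom ℂ)).mahlerMeasure := by
  set Gc := G.map (Int.castRingHom ℂ) with hGc
  have hdeg : Gc.natDegree = G.natDegree :=
    natDegree_map_eq_of_injective (RingHom.injective_int _) _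
  calc (∑ k ∈ range (G.natDegree + 1), |(G.coeff k : ℝ)|)
      = ∑ k ∈ range (G.natDegree + 1), ‖Gc.coeff k‖ := by
        refine Finset.sum_congr rfl fun k _ => ?_
        rw [hGc, coeff_map, eq_intCast, Complex.norm_intCast]
    _ ≤ ∑ k ∈ range (G.natDegree + 1), (G.natDegree.choose k : ℝ) * Gc.mahlerMeasure := by
        refine Finset.sum_le_sum fun k _ => ?_
        simpa [hdeg] using norm_coeff_le_choose_mul_mahlerMeasure k Gc
    _ = 2 ^ G.natDegree * Gc.mahlerMeasure := by
        rw [← Finset.sum_mul]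
        congr 1
        have := Nat.sum_range_choose G.natDegree
        exact_mod_cast this

/-- The Mahler measure of a non-zero integer polynomial is at least `1` — Mathlib's
`Polynomial.one_le_mahlerMeasure_of_ne_zero`, kept under this name for its users (librarian
dedup-01614). [folklore] -/
theorem one_le_mahlerMeasure_map {G : ℤ[X]} (hG : G ≠ 0) :
    1 ≤ (G.map (Int.castRingHom ℂ)).mahlerMeasure :=
  Polynomial.one_le_mahlerMeasure_of_ne_zero hG

/-- `M(G) ≤ L(G)` for an integer polynomial (`Polynomial.mahlerMeasure_le_sum_norm_coeff`).
[folklore] -/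
theorem mahlerMeasure_map_le_length (G : ℤ[X]) :
    (G.map (Int.castRingHom ℂ)).mahlerMeasure ≤ ∑ k ∈ range (G.natDegree + 1), |(G.coeff k : ℝ)| := by
  refine (mahlerMeasure_le_sum_norm_coeff _).trans ?_
  rw [Polynomial.sum_def]
  have hdeg : (G.map (Int.castRingHom ℂ)).natDegree = G.natDegree :=
    natDegree_map_eq_of_injective (RingHom.injective_int _) _
  calc ∑ k ∈ (G.map (Int.castRingHom ℂ)).support, ‖(G.map (Int.castRingHom ℂ)).coeff k‖
      ≤ ∑ k ∈ range (G.natDegree + 1), ‖(G.map (Int.castRingHom ℂ)).coeff k‖ := by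
        refine Finset.sum_le_sum_of_subset_of_nonneg ?_ fun _ _ _ => norm_nonneg _
        rw [← hdeg]
        exact supp_subset_range_natDegree_succ
    _ = ∑ k ∈ range (G.natDegree + 1), |(G.coeff k : ℝ)| := by
        refine Finset.sum_congr rfl fun k _ => ?_
        rw [coeff_map, eq_intCast, Complex.norm_intCast]

/-! ### The resultant over `ℂ` as a product over the roots -/

/-- `∏_{(a,b) ∈ s × t} (a - b) = ∏_{a ∈ s} ∏_{b ∈ t} (a - b)`. [folklore] -/
theorem prod_map_product_sub (s t : Multiset ℂ) :
    ((s ×ˢ t).map fun ij => ij.1 - ij.2).prod = (s.map fun a => (t.map fun b => a - b).prod).prod := by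
  induction s using Multiset.induction_on with
  | empty => simp
  | cons a s ih =>
    rw [Multiset.cons_product, Multiset.map_add, Multiset.prod_add, ih, Multiset.map_cons,
      Multiset.prod_cons, Multiset.map_map]
    rfl

/-- For complex polynomials `f, g` with `f ≠ 0`, `g ≠ 0`:
`Res(f, g) = a^{deg g} ∏_{f(ρ) = 0} g(ρ)`, `a` the leading coefficient of `f` (roots with
multiplicity). [folklore] -/
theorem resultant_eq_pow_mul_prod_roots {f g : ℂ[X]} (hf : f ≠ 0) (hg : g ≠ 0) :
    f.resultant g = f.leadingCoeff ^ g.natDegree * (f.roots.map fun ρ => g.eval ρ).prod := by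
  set a := f.leadingCoeff with ha
  set b := g.leadingCoeff with hb
  have ha0 : a ≠ 0 := leadingCoeff_ne_zero.mpr hf
  have hb0 : b ≠ 0 := leadingCoeff_ne_zero.mpr hg
  set fm := f * C a⁻¹ with hfm
  set gm := g * C b⁻¹ with hgm
  have hfm_monic : fm.Monic := monic_mul_leadingCoeff_inv hf
  have hgm_monic : gm.Monic := monic_mul_leadingCoeff_inv hg
  have hf_eq : f = C a * fm := by
    rw [hfm, mul_comm, mul_assoc, ← C_mul, inv_mul_cancel₀ ha0, C_1, mul_one]
  have hg_eq : g = C b * gm := by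
    rw [hgm, mul_comm, mul_assoc, ← C_mul, inv_mul_cancel₀ hb0, C_1, mul_one]
  have hfm_deg : fm.natDegree = f.natDegree := by
    rw [hfm, mul_comm]; exact natDegree_C_mul (inv_ne_zero ha0)
  have hgm_deg : gm.natDegree = g.natDegree := by
    rw [hgm, mul_comm]; exact natDegree_C_mul (inv_ne_zero hb0)
  have hfm_roots : fm.roots = f.roots := by
    rw [hfm, mul_comm]; exact roots_C_mul _ (inv_ne_zero ha0)
  have hcard : f.roots.card = f.natDegree := by
    rw [← hfm_roots, ← hfm_deg]; exact ((IsAlgClosed.splits fm).natDegree_eq_card_roots).symm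
  -- the resultant of the monic parts
  have hres_m : fm.resultant gm fm.natDegree gm.natDegree =
      (fm.roots.map fun ρ => gm.eval ρ).prod := by
    rw [resultant_eq_prod_roots_sub fm gm hfm_monic hgm_monic (IsAlgClosed.splits _)
      (IsAlgClosed.splits _)]
    rw [prod_map_product_sub]
    congr 1
    refine Multiset.map_congr rfl fun ρ _ => ?_
    conv_rhs => rw [(IsAlgClosed.splits gm).eq_prod_roots_of_monic hgm_monic]
    rw [eval_multiset_prod, Multiset.map_map]
    simp
  -- reinstate the leading coefficients
  have hgm_eval : ∀ ρ, g.eval ρ = b * gm.eval ρ := by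
    intro ρ; rw [hg_eq, eval_mul, eval_C]
  calc f.resultant g = (C a * fm).resultant (C b * gm) f.natDegree g.natDegree := by
          rw [← hf_eq, ← hg_eq]
    _ = a ^ g.natDegree * (b ^ f.natDegree * fm.resultant gm f.natDegree g.natDegree) := by
          rw [resultant_C_mul_left, resultant_C_mul_right]
    _ = a ^ g.natDegree * (b ^ f.natDegree * (fm.roots.map fun ρ => gm.eval ρ).prod) := by
          rw [← hfm_deg, ← hgm_deg, hres_m]
    _ = a ^ g.natDegree * (f.roots.map fun ρ => g.eval ρ).prod := by
          congr 1
          rw [hfm_roots]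
          simp_rw [hgm_eval]
          rw [Multiset.prod_map_mul, Multiset.map_const', Multiset.prod_replicate, hcard]

/-! ### Liouville's inequality -/

/-- **Liouville's inequality** ([NesterenkoWaldschmidt1996, Lemma 5] with `n = 1`, `𝕜 = ℚ(ξ)`,
`D' = D`; Fel'dman 1982, Lemma 9.2). Let `Q ∈ ℤ[X]` be irreducible over `ℚ`, `ξ ∈ ℂ` a root of
`Q`, `d = deg Q`, and let `G ∈ ℤ[X]`, `n = deg G`, with `G(ξ) ≠ 0` and `L(G) ≤ Λ`. Then
`max(1,|ξ|)^n ≤ Λ^{d-1} · M(Q)^n · |G(ξ)|`, i.e. `log |G(ξ)| ≥ -(d-1) log Λ - n log M(Q) + n log⁺|ξ|`,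
where `M(Q) = |a| ∏ max(1,|ξᵢ|)` is the Mahler measure (`= exp(d h(ξ))`).
[cite: NesterenkoWaldschmidt1996, §5 Lemma 5] -/
theorem liouville {Q : ℤ[X]} (hQ : Irreducible (Q.map (Int.castRingHom ℚ))) {ξ : ℂ}
    (hξ : aeval ξ Q = 0) {G : ℤ[X]} (hG : aeval ξ G ≠ 0) {Λ : ℝ}
    (hΛ : ∑ k ∈ range (G.natDegree + 1), |(G.coeff k : ℝ)| ≤ Λ) :
    max 1 ‖ξ‖ ^ G.natDegree ≤
      Λ ^ (Q.natDegree - 1) * (Q.map (Int.castRingHom ℂ)).mahlerMeasure ^ G.natDegree *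
        ‖aeval ξ G‖ := by
  -- names
  set d := Q.natDegree with hd
  set n := G.natDegree with hn
  set Qq := Q.map (Int.castRingHom ℚ) with hQq
  set Gq := G.map (Int.castRingHom ℚ) with hGq
  set Qc := Q.map (Int.castRingHom ℂ) with hQc
  set Gc := G.map (Int.castRingHom ℂ) with hGc
  have hG0 : G ≠ 0 := by rintro rfl; exact hG (map_zero _)
  have hQ0 : Q ≠ 0 := by
    intro h; apply hQ.ne_zero; rw [hQq, h, Polynomial.map_zero]
  have hinjQ : Function.Injective (Int.castRingHom ℚ) := RingHom.injective_int _
  have hinjC : Function.Injective (Int.castRingHom ℂ) := RingHom.injective_int _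
  have hQc0 : Qc ≠ 0 := (Polynomial.map_ne_zero_iff hinjC).mpr hQ0
  have hGc0 : Gc ≠ 0 := (Polynomial.map_ne_zero_iff hinjC).mpr hG0
  have hdegQc : Qc.natDegree = d := natDegree_map_eq_of_injective hinjC _
  have hdegGc : Gc.natDegree = n := natDegree_map_eq_of_injective hinjC _
  have hdegQq : Qq.natDegree = d := natDegree_map_eq_of_injective hinjQ _
  have hdegGq : Gq.natDegree = n := natDegree_map_eq_of_injective hinjQ _
  -- evaluation at `ξ` through the maps
  have haevalC : ∀ (P : ℤ[X]) (z : ℂ), aeval z P = (P.map (Int.castRingHom ℂ)).eval z := by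
    intro P z; rw [aeval_def, eval₂_eq_eval_map]; rfl
  have haevalQ : ∀ P : ℤ[X], aeval ξ (P.map (Int.castRingHom ℚ)) = aeval ξ P := by
    intro P
    have : Int.castRingHom ℚ = algebraMap ℤ ℚ := rfl
    rw [this, aeval_map_algebraMap]
  -- Step 1: `Q` and `G` are coprime over `ℚ`, so the resultant is a non-zero integer.
  have hcop : IsCoprime Qq Gq := by
    rw [hQ.coprime_iff_not_dvd]
    rintro ⟨R, hR⟩
    apply hG
    rw [← haevalQ G, ← hGq, hR, map_mul, haevalQ Q, hξ, zero_mul]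
  have hresQ : Qq.resultant Gq d n ≠ 0 := by
    have := resultant_ne_zero Qq Gq hcop
    rwa [hdegQq, hdegGq] at this
  have hresZ : Q.resultant G d n ≠ 0 := by
    intro h
    apply hresQ
    rw [hQq, hGq, resultant_map_map, h, map_zero]
  have hresC : (1 : ℝ) ≤ ‖Qc.resultant Gc d n‖ := by
    rw [hQc, hGc, resultant_map_map, eq_intCast, Complex.norm_intCast, ← Int.cast_abs]
    exact_mod_cast Int.one_le_abs hresZ
  -- Step 2: the resultant over `ℂ` as a product over the roots of `Q`.
  have hres_eq : Qc.resultant Gc d n =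
      Qc.leadingCoeff ^ n * (Qc.roots.map fun ρ => Gc.eval ρ).prod := by
    rw [← hdegQc, ← hdegGc]; exact resultant_eq_pow_mul_prod_roots hQc0 hGc0
  -- Step 3: isolate the root `ξ`.
  have hξmem : ξ ∈ Qc.roots := by
    rw [mem_roots hQc0, IsRoot.def, ← haevalC Q ξ]; exact hξ
  set rest := Qc.roots.erase ξ with hrest
  have hroots : Qc.roots = ξ ::ₘ rest := (Multiset.cons_erase hξmem).symm
  have hcard_rest : rest.card = d - 1 := by
    have h1 : Qc.roots.card = d := by
      rw [← hdegQc]; exact ((IsAlgClosed.splits Qc).natDegree_eq_card_roots).symm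
    rw [hrest, Multiset.card_erase_of_mem hξmem, h1]
    rfl
  -- Step 4: sizes.
  have hΛ0 : 0 ≤ Λ := (length_nonneg G).trans hΛ
  have hval : ∀ ρ : ℂ, ‖Gc.eval ρ‖ ≤ Λ * max 1 ‖ρ‖ ^ n := by
    intro ρ
    rw [← haevalC G ρ]
    exact (norm_aeval_le_length_mul G ρ).trans
      (mul_le_mul_of_nonneg_right hΛ (pow_nonneg (le_trans zero_le_one (le_max_left _ _)) _))
  have hprod_rest : ‖(rest.map fun ρ => Gc.eval ρ).prod‖ ≤
      Λ ^ (d - 1) * ((rest.map fun ρ => max 1 ‖ρ‖).prod) ^ n := by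
    rw [← hcard_rest]
    clear hcard_rest hroots hrest
    induction rest using Multiset.induction_on with
    | empty => simp
    | cons ρ s ih =>
      simp only [Multiset.map_cons, Multiset.prod_cons, Multiset.card_cons, norm_mul]
      calc ‖Gc.eval ρ‖ * ‖(s.map fun ρ => Gc.eval ρ).prod‖
          ≤ (Λ * max 1 ‖ρ‖ ^ n) * (Λ ^ s.card * ((s.map fun ρ => max 1 ‖ρ‖).prod) ^ n) :=
            mul_le_mul (hval ρ) ih (norm_nonneg _) (by positivity)
        _ = Λ ^ (s.card + 1) * (max 1 ‖ρ‖ * (s.map fun ρ => max 1 ‖ρ‖).prod) ^ n := by ring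
  have hM : Qc.mahlerMeasure = ‖Qc.leadingCoeff‖ * (max 1 ‖ξ‖ * (rest.map fun ρ => max 1 ‖ρ‖).prod) := by
    rw [mahlerMeasure_eq_leadingCoeff_mul_prod_roots, hroots, Multiset.map_cons, Multiset.prod_cons]
  -- Step 5: assemble.
  have key : (1 : ℝ) ≤ ‖aeval ξ G‖ * (Λ ^ (d - 1) *
      (‖Qc.leadingCoeff‖ * (rest.map fun ρ => max 1 ‖ρ‖).prod) ^ n) := by
    calc (1 : ℝ) ≤ ‖Qc.resultant Gc d n‖ := hresC
      _ = ‖Qc.leadingCoeff‖ ^ n * (‖Gc.eval ξ‖ * ‖(rest.map fun ρ => Gc.eval ρ).prod‖) := by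
          rw [hres_eq, hroots, Multiset.map_cons, Multiset.prod_cons, norm_mul, norm_pow, norm_mul]
      _ ≤ ‖Qc.leadingCoeff‖ ^ n * (‖Gc.eval ξ‖ *
            (Λ ^ (d - 1) * ((rest.map fun ρ => max 1 ‖ρ‖).prod) ^ n)) := by
          gcongr
      _ = ‖aeval ξ G‖ * (Λ ^ (d - 1) *
            (‖Qc.leadingCoeff‖ * (rest.map fun ρ => max 1 ‖ρ‖).prod) ^ n) := by
          rw [haevalC G ξ, mul_pow]; ring
  calc max 1 ‖ξ‖ ^ n = max 1 ‖ξ‖ ^ n * 1 := (mul_one _).symm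
    _ ≤ max 1 ‖ξ‖ ^ n * (‖aeval ξ G‖ * (Λ ^ (d - 1) *
          (‖Qc.leadingCoeff‖ * (rest.map fun ρ => max 1 ‖ρ‖).prod) ^ n)) :=
        mul_le_mul_of_nonneg_left key (by positivity)
    _ = Λ ^ (d - 1) * Qc.mahlerMeasure ^ n * ‖aeval ξ G‖ := by
        rw [hM]; ring

end NW1996

end Literature.NumberTheory.Transcendental

end
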